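import Summits.NavierStokesRegularity.NavierStokesRegularity.Theses.StretchingWellBinding
import Summits.NavierStokesRegularity.NavierStokesRegularity.Theses.TypeILiouville
import Summits.NavierStokesRegularity.NavierStokesRegularity.Theses.HalfHolderEnergy
import Summits.NavierStokesRegularity.NavierStokesRegularity.Theorems.StretchingWellBindingEnstrophyQuarterLawWindowToSlice
import Summits.NavierStokesRegularity.NavierStokesRegularity.Theorems.StretchingWellBindingEnstrophyQuarterLawSmoothingEnvelope
import Summits.NavierStokesRegularity.NavierStokesRegularity.Theorems.StretchingWellBindingEnstrophyQuarterLawFarFieldEnstrophy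
import Summits.NavierStokesRegularity.NavierStokesRegularity.Theorems.StretchingWellBindingEnstrophyQuarterLawSieve
import HarnessLib.Audit

/-!
# Line «sparse_sieve» on the shelf crux `StretchingWellBinding.EnstrophyQuarterLaw` (stmt-NavierStokesRegularity-1574)

The complete shelf line obtained by composing `Lines/window_average.lean` (slice law ⇐ window law ∧
sup-rate Type I, converter `WindowToSlice`) with the lever line `Lines/sparse_sieve_hhe.lean` (window law
⇐ uniform local Type I ∧ uniform sparseness ∧ localized smoothing ∧ far field, by the dyadic
ε-regularity sieve). Net statement of the line:

  `EnstrophyQuarterLaw ⇐ TypeIliouvilleNoTypeII (0056) ∧ UniformLocalTypeI ∧ UniformSparseness`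
  `                      ∧ [SmoothingEnvelope, FarFieldEnstrophy: known] ∧ [sieve, WindowToSlice: provable]`.

All three OPEN pieces are velocity-side and typed; `UniformSparseness` ("no satellite swarm": at
every time and scale at most `N₀` separated `ε₀`-concentrating balls) is the ingredient of the
quarter law that no other line or route names (Lines/birth.lean hides it inside `stub_typeICells` =
finitely many cells WITH a vorticity envelope; here: no finiteness of the singular set, no envelope,
no Liouville, no backward uniqueness). The mechanism ("which NS structure bounds dissipation per
short window?" — idea-crit-8): CKN ε-regularity / Barker–Prange–Kang–Miura–Tsai localized smoothing
turns slice-smallness of `L³` outside `N₀` balls per dyadic level into gradient envelopes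
`|∇u| ≲ R_j⁻²`, so shells cost a geometric series `O(N₀√τ)`, the core costs `O(N₀ M √τ)` by the
scaled-dissipation bound `E(z,r) ≤ M`, the far field and the early slab cost `O(τ)`.
Details and the converse (`EnergyHalfHolder ⇒ UniformLocalTypeI ∧ UniformSparseness` by the
dissipation quantum) in `Lines/sparse_sieve.md`. No summit is proved by this line.
`lean check`: rc 0, `sorry` exactly in the seven `stub_*`.

WIRING 2026-08-28 (ns-hhe-c1 g5, statements byte-identical): stubs 3/4/5 are CLOSED BY NAME by the landed
Theorems files (`…SmoothingEnvelope` p614511, `…FarFieldEnstrophy` p607039, `…Sieve` p612439, all ns-hhe-c1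
g0/g2, `--supports stmt-NavierStokesRegularity-1574`), exactly as stub 7 was closed by p608800; `sorry` now
remains exactly in `stub_uniformLocalTypeI` (S1, OPEN), `stub_uniformSparseness` (S2, OPEN) and `stub_noTypeII`
(= stmt-0056, OPEN). No summit is proved by this line; `EnstrophyQuarterLaw` (1574) stays OPEN.
-/

set_option linter.dupNamespace false
set_option linter.unusedVariables false

noncomputable section

open MeasureTheory Set Metric
open scoped ENNReal

namespace Summit.NavierStokesRegularity.NavierStokesRegularity.Cruxes.EnstrophyQuarterLaw.SparseSieve

open Literature.Analysis.FluidPDE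

/-! ### The typed pieces (predicates of one solution `u` on `[0, T)`) -/

/-- **(CT) Uniform local Type I in the CKN quantities `A` and `E`** on the slab of scales `≤ r₀`:
`R⁻¹ ∫_{B_R(x)} |u(s)|² ≤ M` for all `s < T`, `x`, `0 < R ≤ r₀`, and
`R⁻¹ ∫_{b−R²}^{b} ∫_{B_R(x)} |∇u|² ≤ M` for all final times `b ≤ T`. OPEN (holds on Type-I / DSS
strata; Seregin's `G(z₀) < ∞`, `min{…} = ∞` for Type II, Seregin 2014 notes Def. 3.5 / (3.3.15)). -/
def UniformLocalTypeI (T : ℝ) (u : ℝ → EuclideanSpace ℝ (Fin 3) → EuclideanSpace ℝ (Fin 3)) : Prop :=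
  ∃ M r₀ : ℝ, 0 < M ∧ 0 < r₀ ∧
    (∀ s ∈ Set.Ico 0 T, ∀ (x : EuclideanSpace ℝ (Fin 3)), ∀ R ∈ Set.Ioc 0 r₀,
      ∫⁻ y in Metric.ball x R, ‖u s y‖ₑ ^ 2 ≤ ENNReal.ofReal (M * R)) ∧
    (∀ b ∈ Set.Ioc 0 T, ∀ (x : EuclideanSpace ℝ (Fin 3)), ∀ R ∈ Set.Ioc 0 r₀, R ^ 2 ≤ b →
      ∫⁻ t in Set.Ioo (b - R ^ 2) b, ∫⁻ y in Metric.ball x R, ‖fderiv ℝ (u t) y‖ₑ ^ 2 ≤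
        ENNReal.ofReal (M * R))

/-- **(BM) Uniform sparseness of critical concentration AT EVERY THRESHOLD** ("no satellite
swarms"; thresholds LINKED per idea-crit-8 VERDICT on LINE 3, P1⁶): there is a scale `r₀ > 0` such
that for EVERY threshold `ε₀ > 0` some `N₀ = N₀(ε₀)` bounds, at every time `t < T` and every scale
`0 < r ≤ r₀`, the size of any `4r`-separated finite family of centres whose `2r`-balls each carry
`∫ |u(t)|³ ≥ ε₀³`. (On Type-I profile scenarios `N₀(ε₀) ~ (C/ε₀)³ + U E₀/ε₀³`.) The sieve applies it
at the threshold `ε₀ := γ` produced by `SmoothingEnvelope`. OPEN; the new currency of the line. -/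
def UniformSparseness (T : ℝ) (u : ℝ → EuclideanSpace ℝ (Fin 3) → EuclideanSpace ℝ (Fin 3)) : Prop :=
  ∃ r₀ : ℝ, 0 < r₀ ∧ ∀ ε₀ : ℝ, 0 < ε₀ → ∃ N₀ : ℕ,
    ∀ t ∈ Set.Ico 0 T, ∀ r ∈ Set.Ioc 0 r₀, ∀ F : Finset (EuclideanSpace ℝ (Fin 3)),
      (∀ x ∈ F, ∀ y ∈ F, x ≠ y → 4 * r ≤ dist x y) →
      (∀ x ∈ F, ENNReal.ofReal (ε₀ ^ 3) ≤ ∫⁻ y in Metric.ball x (2 * r), ‖u t y‖ₑ ^ 3) →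
      F.card ≤ N₀

/-- **(SE) Smoothing envelope = localized smoothing, quantitative and rescaled** (Barker–Prange 2020
Thm 1 / Kang–Miura–Tsai 2021 Thm 1.1 + interior gradient bound): given a scale-`r₀` local energy
bound with constant `M`, there are `γ, σ > 0` and `C` such that for every final time `b ≤ T`,
centre `x₀` and scale `0 < R ≤ r₀` with restart time `b − σR² ≥ 0`, smallness
`∫_{B_{2R}(x₀)} |u(b − σR²)|³ ≤ γ³` forces the thin-slab dissipation bound
`∫_{t₁}^{b} ∫_{B_{R/4}(x₀)} |∇u|² ≤ C (b − t₁)/R` for all `t₁ ∈ [b − σR²/4, b)`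
(i.e. `|∇u| ≲ R⁻²` there). KNOWN MATHEMATICS, not yet in the tree (the tree's `hT1` is the
qualitative slab form). -/
def SmoothingEnvelope (T : ℝ) (u : ℝ → EuclideanSpace ℝ (Fin 3) → EuclideanSpace ℝ (Fin 3)) : Prop :=
  ∀ M r₀ : ℝ, 0 < M → 0 < r₀ →
    (∀ s ∈ Set.Ico 0 T, ∀ (x : EuclideanSpace ℝ (Fin 3)), ∀ R ∈ Set.Ioc 0 r₀,
      ∫⁻ y in Metric.ball x R, ‖u s y‖ₑ ^ 2 ≤ ENNReal.ofReal (M * R)) →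
    ∃ γ σ C : ℝ, 0 < γ ∧ 0 < σ ∧ 0 ≤ C ∧
      ∀ (b R : ℝ) (x₀ : EuclideanSpace ℝ (Fin 3)), 0 < R → R ≤ r₀ → 0 ≤ b - σ * R ^ 2 → b ≤ T →
        ∫⁻ y in Metric.ball x₀ (2 * R), ‖u (b - σ * R ^ 2) y‖ₑ ^ 3 ≤ ENNReal.ofReal (γ ^ 3) →
        ∀ t₁ ∈ Set.Ico (b - σ * R ^ 2 / 4) b,
          ∫⁻ t in Set.Ioo t₁ b, ∫⁻ y in Metric.ball x₀ (R / 4), ‖fderiv ℝ (u t) y‖ₑ ^ 2 ≤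
            ENNReal.ofReal (C * (b - t₁) / R)

/-- **(FF) Far-field enstrophy bound** on the second half of the life span: outside some ball the
enstrophy stays bounded up to `T` (Tao 2011/2013 Thm 10.1 in the exterior form of Rem. 10.6; tree
fact `NS.tao2011_enstrophyLocalisation_exterior`, to be specialised to these classes). -/
def FarFieldEnstrophy (T : ℝ) (u : ℝ → EuclideanSpace ℝ (Fin 3) → EuclideanSpace ℝ (Fin 3)) : Prop :=
  ∃ ρ B : ℝ, 0 ≤ B ∧ ∀ t ∈ Set.Ico (T / 2) T,
    ∫⁻ x in (Metric.ball (0 : EuclideanSpace ℝ (Fin 3)) ρ)ᶜ, ‖curl (u t) x‖ₑ ^ 2 ≤ ENNReal.ofReal B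

/-- The crux's conclusion for one solution: the **window quarter law** (energy `½`-Hölder). -/
def WindowLaw (T : ℝ) (u : ℝ → EuclideanSpace ℝ (Fin 3) → EuclideanSpace ℝ (Fin 3)) : Prop :=
  ∃ K : ℝ, ∀ a b : ℝ, 0 ≤ a → a ≤ b → b ≤ T →
    ∫⁻ t in Set.Ioo a b, ∫⁻ x, ‖curl (u t) x‖ₑ ^ 2 ≤ ENNReal.ofReal (K * Real.sqrt (b - a))

/-- The converter statement of `Lines/window_average.lean` (verbatim): sup-norm Type I + the window
law ⇒ the slice law, for one solution. -/
def WindowToSlice : Prop :=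
  ∀ (ν T : ℝ), 0 < ν → 0 < T → ∀ (u : ℝ → EuclideanSpace ℝ (Fin 3) → EuclideanSpace ℝ (Fin 3))
    (p : ℝ → EuclideanSpace ℝ (Fin 3) → ℝ), IsMaximalSmoothSolution ν 0 u p T → IsLerayHopfOn T ν 0 (u 0) u →
    HasRapidSpatialDecay (u 0) → IsTypeIBlowup u T →
    (∃ K : ℝ, ∀ a b : ℝ, 0 ≤ a → a ≤ b → b ≤ T →
      ∫⁻ t in Set.Ioo a b, ∫⁻ x, ‖curl (u t) x‖ₑ ^ 2 ≤ ENNReal.ofReal (K * Real.sqrt (b - a))) →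
    ∃ K' : ℝ, ∀ t ∈ Set.Ico 0 T, ∫⁻ x, ‖curl (u t) x‖ₑ ^ 2 ≤ ENNReal.ofReal (K' / Real.sqrt (T - t))

/-! ### Registered stubs -/

/-- STUB 1 (OPEN, XL; Type-I-type hypothesis in CKN currency): uniform local Type I (`A`, `E`) on
the top slab at a first blow-up of a classical Leray–Hopf solution from rapidly decaying data. -/
theorem stub_uniformLocalTypeI : ∀ (ν T : ℝ), 0 < ν → 0 < T →
    ∀ (u : ℝ → EuclideanSpace ℝ (Fin 3) → EuclideanSpace ℝ (Fin 3))
      (p : ℝ → EuclideanSpace ℝ (Fin 3) → ℝ),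
    IsMaximalSmoothSolution ν 0 u p T → IsLerayHopfOn T ν 0 (u 0) u →
    HasRapidSpatialDecay (u 0) → UniformLocalTypeI T u := by
  sorry

/-- STUB 2 (OPEN, XL; the line's new currency): uniform sparseness of `L³`-concentration. -/
theorem stub_uniformSparseness : ∀ (ν T : ℝ), 0 < ν → 0 < T →
    ∀ (u : ℝ → EuclideanSpace ℝ (Fin 3) → EuclideanSpace ℝ (Fin 3))
      (p : ℝ → EuclideanSpace ℝ (Fin 3) → ℝ),
    IsMaximalSmoothSolution ν 0 u p T → IsLerayHopfOn T ν 0 (u 0) u →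
    HasRapidSpatialDecay (u 0) → UniformSparseness T u := by
  sorry

/-- STUB 3 (KNOWN, XL to vendor; Barker–Prange 2020 Thm 1 = Kang–Miura–Tsai 2021 Thm 1.1, made
quantitative, rescaled to scale `R` and viscosity `ν`, restarted from the classical slice
`u(b − σR²)` via `IsGlobalLerayHopf.exists_isLocalEnergySolutionOn_restart`-type restarting, plus the
interior gradient estimate for bounded solutions). -/
theorem stub_smoothingEnvelope : ∀ (ν T : ℝ), 0 < ν → 0 < T →
    ∀ (u : ℝ → EuclideanSpace ℝ (Fin 3) → EuclideanSpace ℝ (Fin 3))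
      (p : ℝ → EuclideanSpace ℝ (Fin 3) → ℝ),
    IsMaximalSmoothSolution ν 0 u p T → IsLerayHopfOn T ν 0 (u 0) u →
    HasRapidSpatialDecay (u 0) → SmoothingEnvelope T u :=
  -- CLOSED 2026-08-28 (p614511, ns-hhe-c1 g2): the landed theorem, predicates unfolded (defeq).
  Summit.NavierStokesRegularity.NavierStokesRegularity.Theorems.EnstrophyQuarterLaw.SparseSieve.stub_smoothingEnvelope

/-- STUB 4 (KNOWN, M; Tao 2011 Thm 10.1 / Rem. 10.6 exterior form, tree fact
`NS.tao2011_enstrophyLocalisation_exterior`, applied on `[T/2, T)` from the smooth slice `u(T/2)`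
whose vorticity is square-integrable and small outside a large ball). -/
theorem stub_farFieldEnstrophy : ∀ (ν T : ℝ), 0 < ν → 0 < T →
    ∀ (u : ℝ → EuclideanSpace ℝ (Fin 3) → EuclideanSpace ℝ (Fin 3))
      (p : ℝ → EuclideanSpace ℝ (Fin 3) → ℝ),
    IsMaximalSmoothSolution ν 0 u p T → IsLerayHopfOn T ν 0 (u 0) u →
    HasRapidSpatialDecay (u 0) → FarFieldEnstrophy T u :=
  -- CLOSED 2026-08-28 (p607039, ns-hhe-c1 g0): the landed theorem, predicate unfolded (defeq).
  Summit.NavierStokesRegularity.NavierStokesRegularity.Theorems.EnstrophyQuarterLaw.SparseSieve.stub_farFieldEnstrophy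

/-- STUB 5 (the SIEVE LEMMA, provable, L; pure measure-theoretic bookkeeping + the proved
early-slab enstrophy bound + `|curl v| ≤ ‖curlCLM‖ |Dv|`): uniform local Type I + uniform sparseness
+ smoothing envelope + far-field bound ⇒ the window quarter law. The dyadic count is spelled out
in the module docstring and in `Lines/sparse_sieve.md`. -/
theorem stub_sieve : ∀ (ν T : ℝ), 0 < ν → 0 < T →
    ∀ (u : ℝ → EuclideanSpace ℝ (Fin 3) → EuclideanSpace ℝ (Fin 3))
      (p : ℝ → EuclideanSpace ℝ (Fin 3) → ℝ),
    IsMaximalSmoothSolution ν 0 u p T → IsLerayHopfOn T ν 0 (u 0) u →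
    HasRapidSpatialDecay (u 0) →
    UniformLocalTypeI T u → UniformSparseness T u → SmoothingEnvelope T u →
    FarFieldEnstrophy T u → WindowLaw T u :=
  -- CLOSED 2026-08-28 (p612439, ns-hhe-c1 g2): the landed sieve lemma, predicates unfolded (defeq).
  Summit.NavierStokesRegularity.NavierStokesRegularity.Theorems.EnstrophyQuarterLaw.SparseSieve.stub_sieve

/-- STUB 6 (OPEN, XL; the sibling crux stmt-NavierStokesRegularity-0056 BY NAME; shared with
`Lines/birth.lean` and `Lines/window_average.lean`): sup-norm Type I at a finite classical lifespan. -/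
theorem stub_noTypeII :
    Summit.NavierStokesRegularity.NavierStokesRegularity.Theses.TypeILiouville.TypeIliouvilleNoTypeII := by
  sorry

/-- STUB 7 (provable, M–L; shared with `Lines/window_average.lean`): enstrophy balance
`Ω' ≤ ‖u‖²_∞ Ω/ν`, Grönwall over the window `[2t − T, t]`, average; constant `K' = 2^{M²/ν} K`. -/
-- CLOSED 2026-08-28 (p608800, ns-hhe-c1 g0): the converter is the landed theorem
-- `Theorems.EnstrophyQuarterLaw.stub_windowToSlice` (type = the body of `WindowToSlice`, defeq).
theorem stub_windowToSlice : WindowToSlice :=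
  Summit.NavierStokesRegularity.NavierStokesRegularity.Theorems.EnstrophyQuarterLaw.stub_windowToSlice

/-! ### The composition (real proof; concludes the shelf crux BY NAME, no hypotheses) -/

/-- **Skeleton theorem.** `EnstrophyQuarterLaw` from the seven stubs, all used by name: the window law
from the sieve (stubs 1–5), then the slice law from sup-rate Type I (stub 6) by the converter (stub 7). -/
theorem EnstrophyQuarterLaw_of : Theses.StretchingWellBinding.EnstrophyQuarterLaw := by
  intro ν T hν hT u p hmax hLH hdec
  exact stub_windowToSlice ν T hν hT u p hmax hLH hdec (stub_noTypeII ν T hν hT u p hmax hLH hdec)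
    (stub_sieve ν T hν hT u p hmax hLH hdec
      (stub_uniformLocalTypeI ν T hν hT u p hmax hLH hdec)
      (stub_uniformSparseness ν T hν hT u p hmax hLH hdec)
      (stub_smoothingEnvelope ν T hν hT u p hmax hLH hdec)
      (stub_farFieldEnstrophy ν T hν hT u p hmax hLH hdec))

end Summit.NavierStokesRegularity.NavierStokesRegularity.Cruxes.EnstrophyQuarterLaw.SparseSieve

end
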